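import Literature.AlgebraicGeometry.Motives.AbelianVarietyBlochFiltration
import HarnessLib

/-!
# The formal skeleton of Bloch's theorem `F^{g+1} CH₀(A) = 0` (Voisin II, proof of Thm. 11.29)

Voisin II proves Bloch's theorem (Thm. 11.29 = Bloch 1976, Thm. 0.1; the tree's named fact
`Bloch1976_pontryaginPower_eq_zero`, equivalently `∀ A, A.blochFiltration (A.dim + 1) = ⊥` by
`bloch1976_pontryaginPower_eq_zero_iff_blochFiltration`) from two lemmas:

* **Lemma 11.30** — `Gr^l_F CH₀(A) = 0` for `l > g`: the graded piece is DIVISIBLE (a quotient of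
  `A(ℂ)^{⊗l}`, by the multilinearity of `(a₁, …, a_l) ↦ ∏ ({aᵢ} - {0})` modulo `F^{l+1}`) and
  KILLED BY `l!` (hard Lefschetz through a complete-intersection curve `C ⊂ A`);
* **Lemma 11.31** — `F^N CH₀(A) = 0` for `N ≫ 0`: along a surjective homomorphism `φ : B → A`,
  `φ_* F^i CH₀(B) = F^i CH₀(A)`; take `B = J(C) ↠ A` and prove the Jacobian case directly
  (Lemma 11.32: generators `{u} ⋆ Φ'_*(D₁ ⋯ D_{g+1})` from Jacobi inversion; Lemma 11.33:
  `D₁ ⋯ D_{g+1} = 0` in `CH₀(C^{(g+1)})`);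

and then `F^{g+1} = F^{g+2} = ⋯ = F^N = 0`. This file proves, over the abstract class map
`cls : G → M` of `Motives/AbelianVarietyBlochFiltration` and then for `CH₀` of a complex abelian
variety, every step of this architecture that is ALGEBRA:

* `blochGen_update_pow_sub_smul_mem` — `{u}⋆({bᴺ}-{0})⋆Π ≡ N·{u}⋆({b}-{0})⋆Π (mod F^{|Π|+2})`,
  the multilinearity behind the divisibility of `Gr_F` (Lemma 11.30);
* `blochFiltrationOf_le_succ_of_smul_mem` / `AbelianVariety.blochFiltration_le_succ_of_smul_mem`
  — the formal half of Lemma 11.30: `N`-divisibility of `G` and "`N` kills the generators of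
  `F^l` modulo `F^{l+1}`" give `F^l = F^{l+1}`;
* `blochFiltrationOf_eq_bot_of_le_succ` / `AbelianVariety.blochFiltration_dim_succ_eq_bot` /
  `Bloch1976_pontryaginPower_eq_zero_of_voisin` — the assembly of Thm. 11.29 from the SHAPES of
  Lemmas 11.30 and 11.31;
* `map_blochFiltrationOf_eq`, `blochFiltrationOf_eq_bot_of_surjective` — Lemma 11.31, first
  paragraph (transfer along a surjection compatible with the class maps);
* `blochFiltrationOf_eq_closure_of_closure_eq_top` — the algebra of Lemma 11.32 (factors may be
  restricted to a generating set of `G`, e.g. the Abel–Jacobi image of the curve).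

Everything is proved; no named fact is introduced.

## What is NOT here (the geometric inputs of the printed proof; none is in the tree)

`l! · Gr^l_F CH₀(A) = 0` for `l > dim A` (hard Lefschetz part of Lemma 11.30); divisibility of
`A(ℂ)` (Mumford §4; conditionally `AbelianVariety.surjective_zsmul_id`); the Jacobian case
(Lemmas 11.32–11.33: Chow groups of symmetric powers, Abel's theorem, birational invariance of
`CH₀`); Jacobi inversion; a surjection `J(C) ↠ A`; `φ_* {b} = {φ b}` for `ChowGroup.pushforward`.
Fed with these, `Bloch1976_pontryaginPower_eq_zero_of_voisin` closes the named fact.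

## References

* [VoisinHodgeII2003] C. Voisin, Hodge Theory and Complex Algebraic Geometry II, CUP 2003,
  §11.3.2 pp. 330–333: Thm. 11.29, Lemmas 11.30–11.33 with proofs.
* [Bloch1976] S. Bloch, Some elementary theorems about algebraic cycles on Abelian varieties,
  Invent. Math. 37 (1976), 215–228, Thm. 0.1.
-/

noncomputable section

open scoped BigOperators

namespace Literature.AlgebraicGeometry.Motives

section Abstract

variable {G : Type*} [CommGroup G] {M : Type*} [AddCommGroup M] (cls : G → M)

/-! ### Divisibility: `{u}⋆({bᴺ}-{0})⋆Π ≡ N·{u}⋆({b}-{0})⋆Π (mod F^{|Π|+2})` -/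

/-- **Multilinearity of the expanded products modulo the next filtration step** (the algebra
behind "`Gr^i_F CH₀(A)` is a quotient of `A^{⊗i}`, hence divisible", Voisin II p. 330): replacing
one factor `{b} - {0}` by `{b^N} - {0}` multiplies the expanded product by `N` modulo
`F^{|s|+2}` (the product has `|s| + 1` factors). Proof: `{bᴺ} - {0} = Σ_{k<N} {bᵏ} ⋆ ({b} - {0})`
(telescoping) and `{bᵏ} ⋆ Π' ≡ Π'` modulo one more factor (`blochGen_sub_blochGen_mul_mem`).
[cite: VoisinHodgeII2003, Lemma 11.30 (proof, p. 330)] -/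
theorem blochGen_update_pow_sub_smul_mem {κ : Type*} [DecidableEq κ] (u b : G) (Q : κ → G)
    {s : Finset κ} {a : κ} (ha : a ∉ s) (N : ℕ) :
    blochGen cls u (Function.update Q a (b ^ N)) (insert a s) -
        (N : ℤ) • blochGen cls u (Function.update Q a b) (insert a s) ∈
      blochFiltrationOf cls (s.card + 2) := by
  -- `C v := {v} ⋆ ({b} - {0}) ⋆ Π = B v - B (v b)`, `B v := {v} ⋆ Π`
  have hoffN : ∀ i ∈ s, Function.update Q a (b ^ N) i = Q i :=
    fun i hi => Function.update_of_ne (ne_of_mem_of_not_mem hi ha) _ _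
  have hoff : ∀ i ∈ s, Function.update Q a b i = Q i :=
    fun i hi => Function.update_of_ne (ne_of_mem_of_not_mem hi ha) _ _
  have hCv : ∀ v, blochGen cls v (Function.update Q a b) (insert a s) =
      blochGen cls v Q s - blochGen cls (v * b) Q s := fun v => by
    rw [blochGen_insert cls v _ ha, Function.update_self, blochGen_congr cls v hoff,
      blochGen_congr cls (v * b) hoff]
  -- telescoping: `{u}⋆({bᴺ}-{0})⋆Π = Σ_{k<N} C (u bᵏ)`
  have tele : blochGen cls u (Function.update Q a (b ^ N)) (insert a s) =
      ∑ k ∈ Finset.range N, blochGen cls (u * b ^ k) (Function.update Q a b) (insert a s) := by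
    rw [blochGen_insert cls u _ ha, Function.update_self, blochGen_congr cls u hoffN,
      blochGen_congr cls (u * b ^ N) hoffN]
    have h := Finset.sum_range_sub' (fun k => blochGen cls (u * b ^ k) Q s) N
    simp only [pow_zero, mul_one] at h
    rw [← h]
    refine Finset.sum_congr rfl fun k _ => ?_
    rw [hCv, mul_assoc, ← pow_succ]
  have hsum : (N : ℤ) • blochGen cls u (Function.update Q a b) (insert a s) =
      ∑ k ∈ Finset.range N, blochGen cls u (Function.update Q a b) (insert a s) := by
    rw [Finset.sum_const, Finset.card_range, natCast_zsmul]
  rw [tele, hsum, ← Finset.sum_sub_distrib]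
  refine AddSubgroup.sum_mem _ fun k _ => ?_
  have hk := blochGen_sub_blochGen_mul_mem cls u (b ^ k) (Function.update Q a b) (insert a s)
  rw [Finset.card_insert_of_notMem ha] at hk
  rw [← neg_sub]
  exact AddSubgroup.neg_mem _ hk

/-- **Formal half of Voisin II, Lemma 11.30.** If `G` is `N`-divisible and `N` kills every
expanded product with exactly `l ≥ 1` factors modulo `F^{l+1}`, then `F^l = F^{l+1}` (i.e.
`Gr^l_F = 0`): write a factor `{b} - {0}` as `{cᴺ} - {0} ≡ N·({c} - {0})`
(`blochGen_update_pow_sub_smul_mem`). In Voisin's proof `G = A(ℂ)` is divisible and `l!` kills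
`Gr^l_F CH₀(A)` for `l > g` ("As it is clearly a divisible group, it must be trivial", p. 330).
[cite: VoisinHodgeII2003, Lemma 11.30] -/
theorem blochFiltrationOf_le_succ_of_smul_mem {l : ℕ} (hl : l ≠ 0) {N : ℕ}
    (hdiv : ∀ x : G, ∃ y : G, y ^ N = x)
    (hkill : ∀ (u : G) (Q : ℕ → G) (s : Finset ℕ), s.card = l →
      (N : ℤ) • blochGen cls u Q s ∈ blochFiltrationOf cls (l + 1)) :
    blochFiltrationOf cls l ≤ blochFiltrationOf cls (l + 1) := by
  classical
  refine (AddSubgroup.closure_le _).2 ?_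
  rintro x ⟨u, Q, s, hs, rfl⟩
  rcases hs.lt_or_eq with hlt | heq
  · exact blochGen_mem cls u Q hlt
  · obtain ⟨a, ha⟩ : s.Nonempty := Finset.card_pos.1 (by omega)
    obtain ⟨c, hc⟩ := hdiv (Q a)
    have hcard : (s.erase a).card + 2 = l + 1 := by
      rw [Finset.card_erase_of_mem ha]; omega
    have h1 := blochGen_update_pow_sub_smul_mem cls u c Q (Finset.notMem_erase a s) N
    rw [hc, Function.update_eq_self, Finset.insert_erase ha, hcard] at h1
    have h2 := hkill u (Function.update Q a c) s heq.symm
    have h3 := AddSubgroup.add_mem _ h1 h2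
    rwa [sub_add_cancel] at h3

/-! ### Assembly: Thm. 11.29 from the shapes of Lemmas 11.30 and 11.31 -/

/-- **Voisin II, proof of Thm. 11.29 (assembly).** If `F^l = F^{l+1}` for every `l > g`
(Lemma 11.30) and `F^N = 0` for some `N` (Lemma 11.31), then `F^{g+1} = 0`:
`F^{g+1} = F^{g+2} = ⋯ = F^{g+1+N} ≤ F^N = 0`. [cite: VoisinHodgeII2003, Thm. 11.29 (proof)] -/
theorem blochFiltrationOf_eq_bot_of_le_succ {g : ℕ}
    (h30 : ∀ l, g < l → blochFiltrationOf cls l ≤ blochFiltrationOf cls (l + 1))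
    (h31 : ∃ N, blochFiltrationOf cls N = ⊥) :
    blochFiltrationOf cls (g + 1) = ⊥ := by
  obtain ⟨N, hN⟩ := h31
  have step : ∀ k, blochFiltrationOf cls (g + 1) ≤ blochFiltrationOf cls (g + 1 + k) := by
    intro k
    induction k with
    | zero => exact le_rfl
    | succ k ih => exact ih.trans (h30 _ (by omega))
  refine le_bot_iff.1 ?_
  calc blochFiltrationOf cls (g + 1) ≤ blochFiltrationOf cls (g + 1 + N) := step N
    _ ≤ blochFiltrationOf cls N := blochFiltrationOf_antitone cls (by omega)
    _ = ⊥ := hN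

/-! ### Transfer along a surjective homomorphism (Lemma 11.31, first paragraph) -/

section Transfer

variable {G' : Type*} [CommGroup G'] {M' : Type*} [AddCommGroup M'] (cls' : G' → M')
  (φ : G →* G') (T : M →+ M') (hT : ∀ x, T (cls x) = cls' (φ x))

include hT in
/-- A homomorphism `φ` and an additive map `T` compatible with the class maps
(`T {x} = {φ x}`, as `φ_*` on `CH₀` for a homomorphism of abelian varieties) carry expanded
products to expanded products. [folklore] -/
theorem map_blochGen {κ : Type*} (u : G) (Q : κ → G) (s : Finset κ) :
    T (blochGen cls u Q s) = blochGen cls' (φ u) (φ ∘ Q) s := by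
  simp only [blochGen, map_sum, map_zsmul, hT, map_mul, map_prod, Function.comp_apply]

include hT in
/-- `φ_* F^n(B) ≤ F^n(A)` ("`φ_*` is a morphism of rings for the Pontryagin product", Voisin II
p. 331). [cite: VoisinHodgeII2003, Lemma 11.31 (proof, first paragraph)] -/
theorem map_blochFiltrationOf_le (n : ℕ) :
    (blochFiltrationOf cls n).map T ≤ blochFiltrationOf cls' n := by
  rw [AddSubgroup.map_le_iff_le_comap, blochFiltrationOf, AddSubgroup.closure_le]
  rintro x ⟨u, Q, s, hs, rfl⟩
  rw [SetLike.mem_coe, AddSubgroup.mem_comap, map_blochGen cls cls' φ T hT]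
  exact blochGen_mem cls' _ _ hs

include hT in
/-- **Voisin II, Lemma 11.31, first paragraph.** Along a SURJECTIVE homomorphism compatible
with the class maps, `φ_* F^n(B) = F^n(A)` ("if `φ` is surjective, we actually have
`φ_* F^i CH₀(B) = F^i CH₀(A)` … Thus, if the result holds for `B`, it also holds for `A`").
[cite: VoisinHodgeII2003, Lemma 11.31 (proof, first paragraph)] -/
theorem map_blochFiltrationOf_eq (hφ : Function.Surjective φ) (n : ℕ) :
    (blochFiltrationOf cls n).map T = blochFiltrationOf cls' n := by
  refine le_antisymm (map_blochFiltrationOf_le cls cls' φ T hT n) ?_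
  rw [blochFiltrationOf, AddSubgroup.closure_le]
  rintro x ⟨u', Q', s, hs, rfl⟩
  obtain ⟨u, rfl⟩ := hφ u'
  have hQ' : Q' = φ ∘ (Function.surjInv hφ ∘ Q') := by
    ext i
    simp [Function.surjInv_eq hφ]
  rw [SetLike.mem_coe, hQ', ← map_blochGen cls cls' φ T hT]
  exact AddSubgroup.mem_map_of_mem T (blochGen_mem cls u _ hs)

include hT in
/-- Consequently `F^n(B) = 0` implies `F^n(A) = 0` along a surjective compatible homomorphism.
[cite: VoisinHodgeII2003, Lemma 11.31 (proof, first paragraph)] -/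
theorem blochFiltrationOf_eq_bot_of_surjective (hφ : Function.Surjective φ) {n : ℕ}
    (h : blochFiltrationOf cls n = ⊥) : blochFiltrationOf cls' n = ⊥ := by
  rw [← map_blochFiltrationOf_eq cls cls' φ T hT hφ n, h, AddSubgroup.map_bot]

end Transfer

/-! ### Generation (the algebra of Lemma 11.32) -/

/-- **Restricting the factors to a generating set** (the algebra of Voisin II, Lemma 11.32: for a
Jacobian, `CH₀(A)_hom` is generated by the `{u} ⋆ ({z} - {0})` with `z` on the curve, by
`{z₁ + ⋯ + z_g} - {0} = {u} ⋆ ({z₁} - {0}) + ({z₂ + ⋯ + z_g} - {0})` and induction). If `S`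
generates `G` as a group, `F^n` is generated by the expanded products all of whose factors
`{Qᵢ} - {0}` have `Qᵢ ∈ S`: the set of admissible values at one index is a subgroup
(`{u}⋆({cd}-{0})⋆Π = {u}⋆({c}-{0})⋆Π + {uc}⋆({d}-{0})⋆Π`,
`{u}⋆({c⁻¹}-{0})⋆Π = -{uc⁻¹}⋆({c}-{0})⋆Π`). [cite: VoisinHodgeII2003, Lemma 11.32 (proof)] -/
theorem blochFiltrationOf_eq_closure_of_closure_eq_top {S : Set G} (hS : Subgroup.closure S = ⊤)
    (n : ℕ) :
    blochFiltrationOf cls n =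
      AddSubgroup.closure {x | ∃ (u : G) (Q : ℕ → G) (s : Finset ℕ),
        n ≤ s.card ∧ (∀ i ∈ s, Q i ∈ S) ∧ blochGen cls u Q s = x} := by
  classical
  set F := AddSubgroup.closure {x | ∃ (u : G) (Q : ℕ → G) (s : Finset ℕ),
    n ≤ s.card ∧ (∀ i ∈ s, Q i ∈ S) ∧ blochGen cls u Q s = x} with hF
  refine le_antisymm ?_ ((AddSubgroup.closure_le _).2 ?_)
  swap
  · rintro x ⟨u, Q, s, hs, -, rfl⟩
    exact blochGen_mem cls u Q hs
  refine (AddSubgroup.closure_le _).2 ?_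
  rintro x ⟨u, Q, s, hs, rfl⟩
  -- induction on a set `t` of indices at which the family is unrestricted
  suffices key : ∀ t : Finset ℕ, ∀ Q' : ℕ → G, (∀ i ∈ s, i ∉ t → Q' i ∈ S) →
      ∀ v, blochGen cls v Q' s ∈ F by
    exact key s Q (fun i hi hi' => (hi' hi).elim) u
  intro t
  induction t using Finset.induction_on with
  | empty =>
    intro Q' hQ' v
    exact AddSubgroup.subset_closure ⟨v, Q', s, hs, fun i hi => hQ' i hi (by simp), rfl⟩
  | insert a t hat ih =>
    intro Q' hQ' v
    by_cases has : a ∈ s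
    swap
    · refine ih Q' (fun i hi hit => hQ' i hi ?_) v
      rintro h
      rcases Finset.mem_insert.1 h with rfl | h
      · exact has hi
      · exact hit h
    -- the admissible values at `a` form a subgroup containing `S`
    let T : Subgroup G :=
      { carrier := {c | ∀ w, blochGen cls w (Function.update Q' a c) s ∈ F}
        one_mem' := fun w => by
          simp only [blochGen_update_of_mem cls w 1 Q' has, mul_one, sub_self]
          exact F.zero_mem
        mul_mem' := fun {c d} hc hd w => by
          have h : blochGen cls w (Function.update Q' a (c * d)) s =
              blochGen cls w (Function.update Q' a c) s +
                blochGen cls (w * c) (Function.update Q' a d) s := by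
            simp only [blochGen_update_of_mem cls _ _ Q' has, mul_assoc]
            abel
          rw [h]
          exact F.add_mem (hc w) (hd (w * c))
        inv_mem' := fun {c} hc w => by
          have h : blochGen cls w (Function.update Q' a c⁻¹) s =
              -blochGen cls (w * c⁻¹) (Function.update Q' a c) s := by
            simp only [blochGen_update_of_mem cls _ _ Q' has, mul_assoc, inv_mul_cancel, mul_one]
            abel
          rw [h]
          exact F.neg_mem (hc (w * c⁻¹)) }
    have hST : S ⊆ T := by
      intro c hc w
      refine ih (Function.update Q' a c) (fun i hi hit => ?_) w
      by_cases hia : i = a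
      · subst hia
        rwa [Function.update_self]
      · rw [Function.update_of_ne hia]
        exact hQ' i hi (by simp [hia, hit])
    have hTtop : (Q' a) ∈ T := by
      have : (⊤ : Subgroup G) ≤ T := hS ▸ (Subgroup.closure_le T).2 hST
      exact this (Subgroup.mem_top _)
    have := hTtop v
    rwa [Function.update_eq_self] at this

end Abstract

/-! ### For `CH₀` of a complex abelian variety -/

section AbelianVariety

variable (A : AbelianVariety ℂ)

/-- **Voisin II, Thm. 11.29 from Lemmas 11.30 and 11.31 (one abelian variety).** If
`F^l CH₀(A) = F^{l+1} CH₀(A)` for all `l > dim A` (Lemma 11.30) and `F^N CH₀(A) = 0` for some `N`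
(Lemma 11.31), then `F^{dim A + 1} CH₀(A) = 0`. [cite: VoisinHodgeII2003, Thm. 11.29 (proof)] -/
theorem AbelianVariety.blochFiltration_dim_succ_eq_bot
    (h30 : ∀ l, A.dim < l → A.blochFiltration l ≤ A.blochFiltration (l + 1))
    (h31 : ∃ N, A.blochFiltration N = ⊥) :
    A.blochFiltration (A.dim + 1) = ⊥ :=
  blochFiltrationOf_eq_bot_of_le_succ A.pointClass h30 h31

/-- **Voisin II, Lemma 11.30, formal half, for `CH₀(A)`.** If `A(ℂ)` is `N`-divisible and `N`
annihilates the expanded products with exactly `l ≥ 1` factors modulo `F^{l+1} CH₀(A)` (Voisin: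
`N = l!` for `l > dim A`, by hard Lefschetz through a complete-intersection curve), then
`F^l CH₀(A) = F^{l+1} CH₀(A)`, i.e. `Gr^l_F CH₀(A) = 0`.
[cite: VoisinHodgeII2003, Lemma 11.30] -/
theorem AbelianVariety.blochFiltration_le_succ_of_smul_mem {l : ℕ} (hl : l ≠ 0) {N : ℕ}
    (hdiv : ∀ P : A.Points ℂ, ∃ R : A.Points ℂ, R ^ N = P)
    (hkill : ∀ (u : A.Points ℂ) (Q : ℕ → A.Points ℂ) (s : Finset ℕ), s.card = l →
      (N : ℤ) • blochGen A.pointClass u Q s ∈ A.blochFiltration (l + 1)) :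
    A.blochFiltration l ≤ A.blochFiltration (l + 1) :=
  blochFiltrationOf_le_succ_of_smul_mem A.pointClass hl hdiv hkill

/-- **Voisin II, Lemma 11.31, first paragraph, for `CH₀`.** For complex abelian varieties `B`,
`A`, a group homomorphism `φ : B(ℂ) → A(ℂ)` SURJECTIVE on complex points and an additive map
`T : CH₀(B) → CH₀(A)` with `T {b} = {φ b}` (in Voisin: `φ_*` for a surjective homomorphism of
abelian varieties), `F^n CH₀(B) = 0` implies `F^n CH₀(A) = 0`.
[cite: VoisinHodgeII2003, Lemma 11.31 (proof, first paragraph)] -/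
theorem AbelianVariety.blochFiltration_eq_bot_of_surjective (B : AbelianVariety ℂ)
    (φ : B.Points ℂ →* A.Points ℂ) (T : ChowGroup B.X.left 0 →+ ChowGroup A.X.left 0)
    (hT : ∀ P, T (B.pointClass P) = A.pointClass (φ P)) (hφ : Function.Surjective φ) {n : ℕ}
    (h : B.blochFiltration n = ⊥) : A.blochFiltration n = ⊥ :=
  blochFiltrationOf_eq_bot_of_surjective B.pointClass A.pointClass φ T hT hφ h

/-- **Voisin II, Thm. 11.29 from Lemmas 11.30 and 11.31 (all abelian varieties): the assembly
of `Bloch1976_pontryaginPower_eq_zero`.** Given, for every complex abelian variety, the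
conclusions of Lemma 11.30 (`F^l = F^{l+1}` for `l > dim A`) and Lemma 11.31 (`F^N = 0` for some
`N`) for the filtration `AbelianVariety.blochFiltration`, Bloch's theorem (the named fact, in its
filed expanded form) follows. The two hypotheses are the geometric content of the printed proof
and are NOT proved in the tree. [cite: VoisinHodgeII2003, Thm. 11.29 (proof)] -/
theorem Bloch1976_pontryaginPower_eq_zero_of_voisin
    (h30 : ∀ (A : AbelianVariety ℂ) (l : ℕ), A.dim < l →
      A.blochFiltration l ≤ A.blochFiltration (l + 1))
    (h31 : ∀ A : AbelianVariety ℂ, ∃ N, A.blochFiltration N = ⊥) :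
    Bloch1976_pontryaginPower_eq_zero :=
  bloch1976_pontryaginPower_eq_zero_iff_blochFiltration.2 fun A =>
    A.blochFiltration_dim_succ_eq_bot (h30 A) (h31 A)

end AbelianVariety

end Literature.AlgebraicGeometry.Motives

end
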